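import Literature.AlgebraicGeometry.HodgeTheory.VHSDataLocallyFlatCharted
import Literature.AlgebraicGeometry.HodgeTheory.PolarizedLimitMixedHodgeStructureProd
import Literature.AlgebraicGeometry.HodgeTheory.LimitMixedHodgeStructureCoordinateChange
import Literature.AlgebraicGeometry.Motives.FamiliesVHSProd
import Literature.AlgebraicGeometry.Motives.HodgeStructureProdEndomorphisms
import Literature.AlgebraicGeometry.Motives.HodgeStructureProdHodgeNorm
import HarnessLib

/-!
# Local period charts of a direct sum `D₁ ⊕ D₂` of polarized `ℤ`-variations: the puncture chart (limit `L₁ ⊕ L₂`, gauge `Γ₁ ⊕ Γ₂`, lattice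
# `Λ₁ × Λ₂`, trivialization `e₁ × e₂`), the interior chart (frame `h₁ ⊕ h₂`, constant `min(κ₁, κ₂)`), flatness, and the closure of the
# (locally) (flat-)charted classes under `⊕`

Topic `Literature/AlgebraicGeometry/HodgeTheory` (namespaces `Literature.AlgebraicGeometry.Motives[.HodgeStructure ∕ .VHSData[.PunctureChart ∕ .InteriorChart]]`,
`….HodgeTheory.[Polarized]LimitMixedHodgeStructure`), lane `lit-hodgefound` (seat `p08`, row g60-#3).  The ADDITIVE companion of
`HodgeTheory/VHSDataPunctureChart` (`PunctureChart.tensor`), `HodgeTheory/VHSDataInteriorChart` (`InteriorChart.tensor`) and `HodgeTheory/VHSDataFlatCharts`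
(`IsFlat.tensor`, `IsFlatCharted.tensor`): with it the chart toolkit is closed under `⊗`, `∨`, Tate twists, `T^{a,b}`, `Hom` AND `⊕`.  DEFINITIONS WITH
BODIES (`VHSData.prodTriv`, `PunctureChart.prod`, `InteriorChart.prod`) and THEOREMS; no named fact, no instance, no notation (D-0026 net debt `0`).

PRINTED SOURCES.  W. Schmid, *Variation of Hodge structure: the singularities of the period mapping*, Invent. Math. 22 (1973), §2: flat trivializations
`V_ℚ = V_ℤ ⊗ ℚ`; polarized variations of the same weight are stable under direct sums.  P. Griffiths, *Periods of integrals on algebraic manifolds III*,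
Publ. Math. IHÉS 38 (1970), §1 (direct sums of variations, e.g. `H^• = ⊕ Hⁱ`, disconnected fibres).  E. Cattani, P. Deligne, A. Kaplan, *On the locus
of Hodge classes*, J. AMS 8 (1995) (held text): §1 (pp. 483–484), (2.4) (p. 488) «on `ℋ^r`, the pullback of the local system `𝒱_ℤ` can be
trivialized», 2.7 (2.7.1) (p. 489) «`Φ(z) = exp(Σ z_jN_j)·exp(Γ(s))·F`, `Γ(s)` holomorphic, `𝔟`-valued, `Γ(0) = 0`».  E. Cattani, F. El Zein,
P. Griffiths, Lê D. T. (eds.), *Hodge Theory* (Math. Notes 49, 2014): Ex. 3.2.23 (2) (direct sums of MHS), Thm. 7.5.6 (functoriality of `I^{p,q}`),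
Def. 8.3.6–8.3.7 and Prop. 8.3.12 (i) (p0359–p0361: polarized mixed nilpotent orbits form an additive — indeed abelian — category; direct sums).
P. Deligne, *La conjecture de Weil II*, (1.6.7) (`W(N₁ ⊕ N₂) = W(N₁) ⊕ W(N₂)`); *Théorie de Hodge II*, 2.1, 2.1.15 (direct sums of Hodge structures and
of polarizations).  J. Carlson, S. Müller-Stach, C. Peters, *Period Mappings and Period Domains* (2017), §2.3 Thm. 2.3.3 (the Hodge metric; orthogonal
sums).

CONTENT.
* §0 linear algebra of `ℂ ⊗ (M₁ × M₂)` along a block map `f ⊕ g` (`f : M₁ → V₁`, `g : M₂ → V₂`): **`(f ⊕ g)_ℂ (S × U) = f_ℂS × g_ℂU`**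
  (`map_prodMap_baseChange_comap_prod`), and `(A ⊕ B)(1 ⊗ (v₁, v₂)) = 0 ↔ A(1 ⊗ v₁) = 0 ∧ B(1 ⊗ v₂) = 0` (`prodEnd_ofRat_eq_zero_iff`: the holomorphic
  equations of a direct sum split).
* §1 the fibre of `D₁ ⊕ D₂` in the chart `e₁ × e₂` (`VHSData.prodTriv`): the polarization becomes `Q₁ ⊕ Q₂` (`prod_form_eq_chart`), `V₁,ℤ ⊕ V₂,ℤ` is
  carried ONTO `Λ₁ × Λ₂` (`prodTriv_toRat_mem`, `exists_prodTriv_toRat_eq`), parallel transport becomes `T₁ ⊕ T₂` (`prodTriv_transport_eq`; identity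
  version `prodTriv_transport_eq_of_apply_transport_eq`), and `F^q(D₁ ⊕ D₂)_s` becomes `(g₁ ⊕ g₂)F^q(H₁ ⊕ H₂)` (`map_prod_hodge_F_eq`).
* §2 **matrix coefficients of `A(s) ⊕ B(s)` are holomorphic** when those of `A`, `B` are (`analyticAt_apply_prodEnd`).
* §3 **the monodromy of `L₁ ⊕ L₂` is `T₁ ⊕ T₂`** (`LimitMixedHodgeStructure.prod_monodromy`: `exp(N₁ ⊕ N₂) = e^{N₁} ⊕ e^{N₂}`), so `Λ₁ × Λ₂` is
  `T`-stable (`monodromy_mem_prod`); `exp(z N_ℂ(L₁ ⊕ L₂)) = e^{zN₁,ℂ} ⊕ e^{zN₂,ℂ}` (`exp_smul_baseChange_prod_N`); **the block sum of two gauges in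
  `𝔟 = ⊕_{a ≤ -1} 𝔤𝔩^{a,b}` lies in `𝔟(L₁ ⊕ L₂)`** (`prodEnd_mem_biSup_endPiece`).
* §4 **`PunctureChart.prod`**: the charts of `D₁`, `D₂` (same weight) along the same `σ` give the chart of `D₁ ⊕ D₂` with limit `L₁ ⊕ L₂`
  (`PolarizedLimitMixedHodgeStructure.prod`), gauge `Γ₁ ⊕ Γ₂` (`exp Γ = exp Γ₁ ⊕ exp Γ₂`: `exp_prod_Γ`), lattice `Λ₁ × Λ₂`, trivialization `e₁ × e₂`,
  height `max(A₀,₁, A₀,₂)` — the key identity being `(e₁ × e₂)_ℂ F^q(D₁ ⊕ D₂)_{σ(z)} = exp(zN)·exp(Γ(s))·F^q(L₁ ⊕ L₂)` («nilpotent orbits and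
  holomorphic gauges add blockwise»); CDK Thm. 1.5 for `D₁ ⊕ D₂` near the puncture with SPLIT equations (`exists_finite_hodgeLocusOfNormLe_prod_iff`),
  everything-or-nothing, Lemma 2.11.
* §5 **`InteriorChart.prod`** (same `ψ`): reference `(H₀₁ ⊕ H₀₂, Q₀₁ ⊕ Q₀₂)`, trivialization `e₁ × e₂`, inverse frame `h₁ ⊕ h₂`, lattice `Λ₁ × Λ₂`,
  constant `min(κ₁, κ₂)` — the metric comparison by `Motives/HodgeStructureProdHodgeNorm` (`‖(e₁ × e₂)w‖₀² = ‖e₁w₁‖₀² + ‖e₂w₂‖₀²`).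
* §6 **flatness is stable under `⊕`** (`InteriorChart.IsFlat.prod`, `PunctureChart.IsFlat.prod`) and **the four charted classes are closed under
  `⊕`**: `IsCharted.prod`, `IsFlatCharted.prod`, `IsLocallyCharted.prod`, `IsLocallyFlatCharted.prod`.
* §7 CDK over a curve for `D₁ ⊕ D₂` from (flat) charts of the summands: Thm. 1.1 (`hodgeLocusOfNormLe_prod_eq_univ_or_finite(_of_compactification)`
  — for the record: by the tree's chart-free `hodgeLocusOfNormLe_prod_eq_union` it also follows from the summands separately) and Cor. 1.3 for a pair
  `(u₁, u₂)` (`determinationLocus_prod_eq_univ_or_finite(_of_compactification)`: the set of `t` where ONE path class makes BOTH `γ·u₁`, `γ·u₂` Hodge).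

HONEST SCOPE.  Charts are HYPOTHESIS structures (for honest polarized `ℤ`VHS they come from simply connected coordinate discs and the nilpotent orbit
theorem — cite only); this file shows the hypotheses are stable under `⊕`.  Same weight only (as for `VHSData.prod`).  Not here: off-diagonal data
(extensions of variations), several variables.

## References

* [CattaniDeligneKaplan1995] E. Cattani, P. Deligne, A. Kaplan, *On the locus of Hodge classes*, J. Amer. Math. Soc. 8 (1995) 483–506: §1 (pp. 483–484),
  Thm. 1.1, Cor. 1.2, Cor. 1.3, Thm. 1.5 (p. 485), (2.4), Thm. 2.5 (p. 488), 2.7 (2.7.1) (p. 489), 2.10, Lemma 2.11, 2.12 (pp. 490–491).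
* [Schmid1973] W. Schmid, *Variation of Hodge structure: the singularities of the period mapping*, Invent. Math. 22 (1973), §2, (4.9)–(4.12) (cite only).
* [Griffiths1970] P. Griffiths, *Periods of integrals on algebraic manifolds III*, Publ. Math. IHÉS 38 (1970), §1.
* [CattaniElZeinGriffithsLe2014] E. Cattani et al. (eds.), *Hodge Theory*, Math. Notes 49 (2014): Ex. 3.2.23 (2), Thm. 7.5.6, (7.6.2), Def. 8.3.6–8.3.7
  (p. 359), Prop. 8.3.12 (i) (p. 361).
* [Deligne1980] P. Deligne, *La conjecture de Weil. II*, Publ. Math. IHÉS 52 (1980), (1.6.7).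
* [DeligneHodgeII1971] P. Deligne, *Théorie de Hodge II*, Publ. Math. IHÉS 40 (1971), 2.1, 2.1.15.
* [Deligne1970] P. Deligne, *Équations différentielles à points singuliers réguliers*, LNM 163 (1970), I.1.
* [CarlsonMullerStachPeters2017] J. Carlson, S. Müller-Stach, C. Peters, *Period Mappings and Period Domains*, 2nd ed. (2017), §2.1, §2.3 Thm. 2.3.3.
* [FritzscheGrauert2002] K. Fritzsche, H. Grauert, *From Holomorphic Functions to Complex Manifolds*, GTM 213 (2002), Ch. I §8.
-/

noncomputable section

open scoped TensorProduct ComplexOrder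
open _root_.Topology _root_.Filter Set

namespace Literature.AlgebraicGeometry

open Module
open Motives Motives.MixedHodgeStructure Motives.HodgeStructure
open Motives.HodgeStructure (conj ofRat ofRat_apply conj_ofRat prodEquiv prodEnd)
open HodgeTheory Topology

universe u

namespace Motives.HodgeStructure

/-! ## §0 Linear algebra of `ℂ ⊗ (M₁ × M₂)` along a block map `f ⊕ g` -/

variable {V₁ V₂ : Type u} [AddCommGroup V₁] [Module ℚ V₁] [AddCommGroup V₂] [Module ℚ V₂]
variable {M₁ M₂ : Type} [AddCommGroup M₁] [Module ℚ M₁] [AddCommGroup M₂] [Module ℚ M₂]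

/-- **`(f ⊕ g)_ℂ (S × U) = f_ℂ S × g_ℂ U`** for subspaces `S ⊆ M₁,ℂ`, `U ⊆ M₂,ℂ` (read through the identifications `prodEquiv`): the block map `f ⊕ g`
acts blockwise on products of subspaces (the tree's `map_prodEnd_comap_prod` for maps between different spaces). [cite: DeligneHodgeII1971, 2.1]
[cite: CattaniElZeinGriffithsLe2014, Ex. 3.2.23 (2)] -/
theorem map_prodMap_baseChange_comap_prod (f : M₁ →ₗ[ℚ] V₁) (g : M₂ →ₗ[ℚ] V₂) (A : Submodule ℂ (ℂ ⊗[ℚ] M₁)) (B : Submodule ℂ (ℂ ⊗[ℚ] M₂)) :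
    ((A.prod B).comap (prodEquiv M₁ M₂ : ℂ ⊗[ℚ] (M₁ × M₂) →ₗ[ℂ] _)).map ((f.prodMap g).baseChange ℂ) =
      ((A.map (f.baseChange ℂ)).prod (B.map (g.baseChange ℂ))).comap (prodEquiv V₁ V₂ : ℂ ⊗[ℚ] (V₁ × V₂) →ₗ[ℂ] _) := by
  ext z
  simp only [Submodule.mem_map, Submodule.mem_comap, LinearEquiv.coe_coe, Submodule.mem_prod]
  constructor
  · rintro ⟨w, ⟨hw₁, hw₂⟩, rfl⟩
    rw [Polarization.prodEquiv_prodMap_baseChange_components]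
    exact ⟨⟨_, hw₁, rfl⟩, ⟨_, hw₂, rfl⟩⟩
  · rintro ⟨⟨x, hx, hx'⟩, ⟨y, hy, hy'⟩⟩
    refine ⟨(prodEquiv M₁ M₂).symm (x, y), ?_, ?_⟩
    · rw [LinearEquiv.apply_symm_apply]; exact ⟨hx, hy⟩
    · apply (prodEquiv V₁ V₂).injective
      rw [Polarization.prodEquiv_prodMap_baseChange_components, LinearEquiv.apply_symm_apply, hx', hy', Prod.mk.eta]

/-- **The holomorphic equations of a direct sum split**: `(A ⊕ B)(1 ⊗ (v₁, v₂)) = 0 ↔ A(1 ⊗ v₁) = 0 ∧ B(1 ⊗ v₂) = 0`.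
[cite: CattaniElZeinGriffithsLe2014, Ex. 3.2.23 (2)] [cite: CattaniDeligneKaplan1995, Thm. 1.5 (p. 485)] -/
theorem prodEnd_ofRat_eq_zero_iff (A : Module.End ℂ (ℂ ⊗[ℚ] V₁)) (B : Module.End ℂ (ℂ ⊗[ℚ] V₂)) (v : V₁ × V₂) :
    prodEnd A B (ofRat v) = 0 ↔ A (ofRat v.1) = 0 ∧ B (ofRat v.2) = 0 := by
  rw [← (prodEquiv V₁ V₂).map_eq_zero_iff, prodEquiv_prodEnd_apply, ← Prod.mk.eta (p := v), prodEquiv_ofRat, Prod.mk_eq_zero]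

end Motives.HodgeStructure

namespace Motives.VHSData

variable {S : Type} [TopologicalSpace S] {k : ℤ} (D₁ D₂ : VHSData S k)
variable {V₁ V₂ : Type u} [AddCommGroup V₁] [Module ℚ V₁] [AddCommGroup V₂] [Module ℚ V₂]

/-! ## §1 The fibre of `D₁ ⊕ D₂` in the flat trivialization `e₁ × e₂` -/

/-- **The identification `e₁ × e₂ : V₁,s ⊕ V₂,s ≃ V₁ × V₂`** of the fibre of `D₁ ⊕ D₂` induced by identifications of the summands (the flat trivialization
of a direct sum of local systems is the direct sum of the trivializations; Mathlib's `LinearEquiv.prodCongr` retyped on the fibre of `D₁ ⊕ D₂`).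
[cite: Deligne1970, I.1] [cite: Schmid1973, §2] -/
def prodTriv {s : S} (e₁ : D₁.V.fiber s ≃ₗ[ℚ] V₁) (e₂ : D₂.V.fiber s ≃ₗ[ℚ] V₂) : (D₁.prod D₂).V.fiber s ≃ₗ[ℚ] V₁ × V₂ :=
  e₁.prodCongr e₂

variable {s : S} (e₁ : D₁.V.fiber s ≃ₗ[ℚ] V₁) (e₂ : D₂.V.fiber s ≃ₗ[ℚ] V₂)

/-- `(e₁ × e₂)(x, y) = (e₁ x, e₂ y)`. [cite: Deligne1970, I.1] -/
@[simp] theorem prodTriv_mk (x : D₁.V.fiber s) (y : D₂.V.fiber s) :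
    prodTriv D₁ D₂ e₁ e₂ ((x, y) : D₁.V.fiber s × D₂.V.fiber s) = (e₁ x, e₂ y) := rfl

/-- `e₁ × e₂` on the fibre `V₁,s × V₂,s` is componentwise. [cite: Deligne1970, I.1] -/
theorem prodTriv_apply (x : D₁.V.fiber s × D₂.V.fiber s) : prodTriv D₁ D₂ e₁ e₂ x = (e₁ x.1, e₂ x.2) := rfl

/-- The linear map underlying `e₁ × e₂` is the block map `e₁ ⊕ e₂`. [cite: Deligne1970, I.1] -/
theorem prodTriv_toLinearMap :
    (prodTriv D₁ D₂ e₁ e₂).toLinearMap = (e₁.toLinearMap.prodMap e₂.toLinearMap : D₁.V.fiber s × D₂.V.fiber s →ₗ[ℚ] V₁ × V₂) :=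
  LinearMap.ext fun _ => rfl

/-- **The polarization of `D₁ ⊕ D₂` in the chart `e₁ × e₂` is the orthogonal sum `Q₁ ⊕ Q₂`** when `eᵢ` carries `Qᵢ,s` to `Qᵢ`.
[cite: DeligneHodgeII1971, 2.1.15] [cite: Schmid1973, §2] -/
theorem prod_form_eq_chart (Q₁ : LinearMap.BilinForm ℚ V₁) (Q₂ : LinearMap.BilinForm ℚ V₂)
    (hQ₁ : ∀ x y : D₁.V.fiber s, (D₁.form s).form x y = Q₁ (e₁ x) (e₁ y))
    (hQ₂ : ∀ x y : D₂.V.fiber s, (D₂.form s).form x y = Q₂ (e₂ x) (e₂ y)) (x y : D₁.V.fiber s × D₂.V.fiber s) :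
    ((D₁.prod D₂).form s).form x y = Q₁ (prodTriv D₁ D₂ e₁ e₂ x).1 (prodTriv D₁ D₂ e₁ e₂ y).1 + Q₂ (prodTriv D₁ D₂ e₁ e₂ x).2 (prodTriv D₁ D₂ e₁ e₂ y).2 := by
  rw [prod_form_form, hQ₁, hQ₂]
  rfl

variable {Λ₁ : Submodule ℤ V₁} {Λ₂ : Submodule ℤ V₂}

/-- **`(e₁ × e₂)(V₁,ℤ,s ⊕ V₂,ℤ,s) ⊆ Λ₁ × Λ₂`** when `eᵢ(Vᵢ,ℤ,s) ⊆ Λᵢ`. [cite: Schmid1973, §2] -/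
theorem prodTriv_toRat_mem (h₁ : ∀ u : D₁.VZ.fiber s, e₁ (D₁.toRat s u) ∈ Λ₁) (h₂ : ∀ u : D₂.VZ.fiber s, e₂ (D₂.toRat s u) ∈ Λ₂)
    (u : D₁.VZ.fiber s × D₂.VZ.fiber s) : prodTriv D₁ D₂ e₁ e₂ ((D₁.prod D₂).toRat s u) ∈ Λ₁.prod Λ₂ := by
  obtain ⟨m₁, m₂⟩ := u
  rw [prod_toRat_apply, prodTriv_mk]
  exact Submodule.mem_prod.2 ⟨h₁ m₁, h₂ m₂⟩

/-- **`Λ₁ × Λ₂ ⊆ (e₁ × e₂)(V₁,ℤ,s ⊕ V₂,ℤ,s)`** when `Λᵢ ⊆ eᵢ(Vᵢ,ℤ,s)`. [cite: Schmid1973, §2] -/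
theorem exists_prodTriv_toRat_eq (h₁ : ∀ v ∈ Λ₁, ∃ u : D₁.VZ.fiber s, e₁ (D₁.toRat s u) = v)
    (h₂ : ∀ w ∈ Λ₂, ∃ u : D₂.VZ.fiber s, e₂ (D₂.toRat s u) = w) (v : V₁ × V₂) (hv : v ∈ Λ₁.prod Λ₂) :
    ∃ u : (D₁.prod D₂).VZ.fiber s, prodTriv D₁ D₂ e₁ e₂ ((D₁.prod D₂).toRat s u) = v := by
  obtain ⟨u₁, hu₁⟩ := h₁ v.1 (Submodule.mem_prod.1 hv).1
  obtain ⟨u₂, hu₂⟩ := h₂ v.2 (Submodule.mem_prod.1 hv).2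
  refine ⟨((u₁, u₂) : D₁.VZ.fiber s × D₂.VZ.fiber s), ?_⟩
  rw [prod_toRat_apply, prodTriv_mk, hu₁, hu₂]

/-- **Parallel transport of `D₁ ⊕ D₂` in the chart**: if `eᵢ` intertwines transport along `γ` with `Tᵢ`, then `e₁ × e₂` intertwines the transport
`γ_* ⊕ γ_*` of `D₁ ⊕ D₂` with `T₁ ⊕ T₂`. [cite: Deligne1970, I.1] [cite: CattaniDeligneKaplan1995, (2.4) (p. 488)] -/
theorem prodTriv_transport_eq (γ : Path.Homotopic.Quotient s s) (T₁ : V₁ →ₗ[ℚ] V₁) (T₂ : V₂ →ₗ[ℚ] V₂)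
    (hγ₁ : ∀ x : D₁.V.fiber s, e₁ (D₁.V.transport γ x) = T₁ (e₁ x)) (hγ₂ : ∀ x : D₂.V.fiber s, e₂ (D₂.V.transport γ x) = T₂ (e₂ x))
    (x : D₁.V.fiber s × D₂.V.fiber s) :
    prodTriv D₁ D₂ e₁ e₂ ((D₁.prod D₂).V.transport γ x) = (T₁.prodMap T₂) (prodTriv D₁ D₂ e₁ e₂ x) := by
  change (e₁ (D₁.V.transport γ x.1), e₂ (D₂.V.transport γ x.2)) = (T₁ (e₁ x.1), T₂ (e₂ x.2))
  rw [hγ₁, hγ₂]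

/-- **`e₁ × e₂` is flat along a path class along which `e₁` and `e₂` are**: `(e₁′ × e₂′)((γ·) ⊕ (γ·))(w) = (e₁ × e₂)(w)` on the fibre of `D₁ ⊕ D₂`.
[cite: Deligne1970, I.1] [cite: Schmid1973, §2] -/
theorem prodTriv_transport_eq_of_apply_transport_eq {t : S} (e₁' : D₁.V.fiber t ≃ₗ[ℚ] V₁) (e₂' : D₂.V.fiber t ≃ₗ[ℚ] V₂) (γ : Path.Homotopic.Quotient s t)
    (h₁ : ∀ x : D₁.V.fiber s, e₁' (D₁.V.transport γ x) = e₁ x) (h₂ : ∀ y : D₂.V.fiber s, e₂' (D₂.V.transport γ y) = e₂ y)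
    (w : D₁.V.fiber s × D₂.V.fiber s) :
    prodTriv D₁ D₂ e₁' e₂' ((D₁.prod D₂).V.transport γ w) = prodTriv D₁ D₂ e₁ e₂ w := by
  change (e₁' (D₁.V.transport γ w.1), e₂' (D₂.V.transport γ w.2)) = (e₁ w.1, e₂ w.2)
  rw [h₁, h₂]

/-- **The Hodge filtration of `D₁ ⊕ D₂` in the chart `e₁ × e₂`** (fibre of `D₁ ⊕ D₂`): `(e₁ × e₂)_ℂ F^q(D₁ ⊕ D₂)_s = (g₁ ⊕ g₂)F^q(H₁ ⊕ H₂)` when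
`(eᵢ)_ℂ F^q(Dᵢ)_s = gᵢF^q(Hᵢ)` for all `q` (`F^q` of a direct sum is the product, on both sides). [cite: DeligneHodgeII1971, 2.1] [cite: Schmid1973, §2]
[cite: CattaniElZeinGriffithsLe2014, Ex. 3.2.23 (2)] -/
theorem map_prod_hodge_F_eq (H₁ : MixedHodgeStructure V₁) (H₂ : MixedHodgeStructure V₂) (g₁ : Module.End ℂ (ℂ ⊗[ℚ] V₁))
    (g₂ : Module.End ℂ (ℂ ⊗[ℚ] V₂)) (hF₁ : ∀ q : ℤ, ((D₁.hodge s).F q).map (e₁.toLinearMap.baseChange ℂ) = (H₁.F q).map g₁)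
    (hF₂ : ∀ q : ℤ, ((D₂.hodge s).F q).map (e₂.toLinearMap.baseChange ℂ) = (H₂.F q).map g₂) (q : ℤ) :
    (((D₁.prod D₂).hodge s).F q).map ((prodTriv D₁ D₂ e₁ e₂).toLinearMap.baseChange ℂ) = ((H₁.prod H₂).F q).map (prodEnd g₁ g₂) := by
  rw [MixedHodgeStructure.prod_F, map_prodEnd_comap_prod, ← hF₁, ← hF₂, prodTriv_toLinearMap]
  exact map_prodMap_baseChange_comap_prod e₁.toLinearMap e₂.toLinearMap ((D₁.hodge s).F q) ((D₂.hodge s).F q)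

/-- **Pull-back form for interior charts**: `(e₁ × e₂)_ℂ F^q(D₁ ⊕ D₂)_s = (h₁ ⊕ h₂)⁻¹ F^q(H₀₁ ⊕ H₀₂)` when `(eᵢ)_ℂ F^q(Dᵢ)_s = hᵢ⁻¹F^q(H₀ᵢ)` for all
`q` (pure reference structures of weight `k`). [cite: DeligneHodgeII1971, 2.1] [cite: CattaniDeligneKaplan1995, §1 (p. 483)] -/
theorem map_prod_hodge_F_eq_comap (H₀₁ : HodgeStructure V₁ k) (H₀₂ : HodgeStructure V₂ k) (h₁ : Module.End ℂ (ℂ ⊗[ℚ] V₁))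
    (h₂ : Module.End ℂ (ℂ ⊗[ℚ] V₂)) (hF₁ : ∀ q : ℤ, ((D₁.hodge s).F q).map (e₁.toLinearMap.baseChange ℂ) = (H₀₁.F q).comap h₁)
    (hF₂ : ∀ q : ℤ, ((D₂.hodge s).F q).map (e₂.toLinearMap.baseChange ℂ) = (H₀₂.F q).comap h₂) (q : ℤ) :
    (((D₁.prod D₂).hodge s).F q).map ((prodTriv D₁ D₂ e₁ e₂).toLinearMap.baseChange ℂ) = ((H₀₁.prod H₀₂).F q).comap (prodEnd h₁ h₂) := by
  rw [HodgeStructure.prod_F, comap_prodEnd_comap_prod, ← hF₁, ← hF₂, prodTriv_toLinearMap]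
  exact map_prodMap_baseChange_comap_prod e₁.toLinearMap e₂.toLinearMap ((D₁.hodge s).F q) ((D₂.hodge s).F q)

end Motives.VHSData

/-! ## §2 Matrix coefficients of `A(s) ⊕ B(s)` are holomorphic -/

namespace Motives.HodgeStructure

variable {V₁ V₂ : Type u} [AddCommGroup V₁] [Module ℚ V₁] [AddCommGroup V₂] [Module ℚ V₂]

/-- `φ((A ⊕ B) w) = φ₁(A w₁) + φ₂(B w₂)` with `φ₁ = φ ∘ ι⁻¹ ∘ in₁`, `φ₂ = φ ∘ ι⁻¹ ∘ in₂`, `wᵢ = (ι w)ᵢ`. [cite: CattaniElZeinGriffithsLe2014, Ex. 3.2.23 (2)] -/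
theorem apply_prodEnd_eq_add (φ : Module.Dual ℂ (ℂ ⊗[ℚ] (V₁ × V₂))) (A : Module.End ℂ (ℂ ⊗[ℚ] V₁)) (B : Module.End ℂ (ℂ ⊗[ℚ] V₂))
    (w : ℂ ⊗[ℚ] (V₁ × V₂)) :
    φ (prodEnd A B w) =
      (φ ∘ₗ ((prodEquiv V₁ V₂).symm : (ℂ ⊗[ℚ] V₁) × (ℂ ⊗[ℚ] V₂) →ₗ[ℂ] ℂ ⊗[ℚ] (V₁ × V₂)) ∘ₗ LinearMap.inl ℂ (ℂ ⊗[ℚ] V₁) (ℂ ⊗[ℚ] V₂))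
          (A (prodEquiv V₁ V₂ w).1) +
        (φ ∘ₗ ((prodEquiv V₁ V₂).symm : (ℂ ⊗[ℚ] V₁) × (ℂ ⊗[ℚ] V₂) →ₗ[ℂ] ℂ ⊗[ℚ] (V₁ × V₂)) ∘ₗ LinearMap.inr ℂ (ℂ ⊗[ℚ] V₁) (ℂ ⊗[ℚ] V₂))
          (B (prodEquiv V₁ V₂ w).2) := by
  simp only [LinearMap.comp_apply, LinearEquiv.coe_coe, LinearMap.inl_apply, LinearMap.inr_apply, ← map_add, Prod.mk_add_mk, add_zero, zero_add]
  rw [prodEnd_apply]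

/-- **The matrix coefficients `s ↦ φ((A(s) ⊕ B(s))w)` are holomorphic at `c` when those of `A` and `B` are** (`φ((A ⊕ B)w) = φ₁(Aw₁) + φ₂(Bw₂)`).
[cite: CattaniDeligneKaplan1995, 2.7 (p. 489)] [cite: FritzscheGrauert2002, Ch. I §8] -/
theorem analyticAt_apply_prodEnd {A : ℂ → Module.End ℂ (ℂ ⊗[ℚ] V₁)} {B : ℂ → Module.End ℂ (ℂ ⊗[ℚ] V₂)} {c : ℂ}
    (hA : ∀ (φ : Module.Dual ℂ (ℂ ⊗[ℚ] V₁)) (w : ℂ ⊗[ℚ] V₁), AnalyticAt ℂ (fun s => φ (A s w)) c)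
    (hB : ∀ (φ : Module.Dual ℂ (ℂ ⊗[ℚ] V₂)) (w : ℂ ⊗[ℚ] V₂), AnalyticAt ℂ (fun s => φ (B s w)) c)
    (φ : Module.Dual ℂ (ℂ ⊗[ℚ] (V₁ × V₂))) (w : ℂ ⊗[ℚ] (V₁ × V₂)) : AnalyticAt ℂ (fun s => φ (prodEnd (A s) (B s) w)) c := by
  simp only [apply_prodEnd_eq_add]
  exact (hA _ _).add (hB _ _)

end Motives.HodgeStructure

/-! ## §3 The monodromy of `L₁ ⊕ L₂` is `T₁ ⊕ T₂`; block sums of gauges -/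

namespace HodgeTheory.LimitMixedHodgeStructure

variable {V₁ V₂ : Type u} [AddCommGroup V₁] [Module ℚ V₁] [AddCommGroup V₂] [Module ℚ V₂] {k : ℤ}
  (L₁ : LimitMixedHodgeStructure V₁ k) (L₂ : LimitMixedHodgeStructure V₂ k)

/-- **The monodromy of `L₁ ⊕ L₂` is `T₁ ⊕ T₂`**: `exp(N₁ ⊕ N₂) = e^{N₁} ⊕ e^{N₂}` (`N = log(T₁ ⊕ T₂) = log T₁ ⊕ log T₂`). [cite: Deligne1980, (1.6.7)]
[cite: CattaniElZeinGriffithsLe2014, Def. 7.5.9 and Ex. 3.2.23 (2)] -/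
theorem prod_monodromy : (L₁.prod L₂).monodromy = L₁.monodromy.prodMap L₂.monodromy := by
  rw [monodromy, prod_N, exp_prodMap L₁.isNilpotent_N L₂.isNilpotent_N]
  rfl

/-- `T(v, w) = (T₁ v, T₂ w)`. [cite: Deligne1980, (1.6.7)] -/
theorem prod_monodromy_apply (x : V₁ × V₂) : (L₁.prod L₂).monodromy x = (L₁.monodromy x.1, L₂.monodromy x.2) := by
  rw [prod_monodromy, LinearMap.prodMap_apply]

/-- **`exp(z N(L₁ ⊕ L₂)_ℂ) = e^{zN₁,ℂ} ⊕ e^{zN₂,ℂ}`** (nilpotent orbits add blockwise). [cite: CattaniElZeinGriffithsLe2014, Def. 8.3.6 (i) (p. 359) and (7.5.8)] -/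
theorem exp_smul_baseChange_prod_N (z : ℂ) :
    IsNilpotent.exp (z • (L₁.prod L₂).N.baseChange ℂ) = prodEnd (IsNilpotent.exp (z • L₁.N.baseChange ℂ)) (IsNilpotent.exp (z • L₂.N.baseChange ℂ)) := by
  rw [prod_N, baseChange_prodMap_eq_prodEnd, ← prodEnd_smul, exp_prodEnd (L₁.isNilpotent_N_baseChange.smul z) (L₂.isNilpotent_N_baseChange.smul z)]

end HodgeTheory.LimitMixedHodgeStructure

namespace HodgeTheory.PolarizedLimitMixedHodgeStructure

variable {V₁ V₂ : Type u} [AddCommGroup V₁] [Module ℚ V₁] [FiniteDimensional ℚ V₁] [AddCommGroup V₂] [Module ℚ V₂]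
  [FiniteDimensional ℚ V₂] {k : ℤ} (L₁ : PolarizedLimitMixedHodgeStructure V₁ k) (L₂ : PolarizedLimitMixedHodgeStructure V₂ k)

/-- The monodromy of the polarized direct sum `L₁ ⊕ L₂` is `T₁ ⊕ T₂`. [cite: CattaniElZeinGriffithsLe2014, Prop. 8.3.12 (i) (p. 361)] -/
theorem prod_monodromy : (L₁.prod L₂).monodromy = L₁.monodromy.prodMap L₂.monodromy :=
  LimitMixedHodgeStructure.prod_monodromy _ _

/-- **`Λ₁ × Λ₂` is stable under the monodromy `T₁ ⊕ T₂` of `L₁ ⊕ L₂`** when `Λᵢ` is `Tᵢ`-stable. [cite: CattaniDeligneKaplan1995, §2 (2.4) (p. 488)] -/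
theorem monodromy_mem_prod {Λ₁ : Submodule ℤ V₁} {Λ₂ : Submodule ℤ V₂} (h₁ : ∀ v ∈ Λ₁, L₁.monodromy v ∈ Λ₁) (h₂ : ∀ w ∈ Λ₂, L₂.monodromy w ∈ Λ₂)
    (u : V₁ × V₂) (hu : u ∈ Λ₁.prod Λ₂) : (L₁.prod L₂).monodromy u ∈ Λ₁.prod Λ₂ := by
  rw [prod_monodromy, LinearMap.prodMap_apply]
  exact Submodule.mem_prod.2 ⟨h₁ _ (Submodule.mem_prod.1 hu).1, h₂ _ (Submodule.mem_prod.1 hu).2⟩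

/-- **The gauge of `L₁ ⊕ L₂`**: if `X ∈ ⊕_{a ≤ -1} 𝔤𝔩(L₁)^{a,b}` and `Y ∈ ⊕_{a ≤ -1} 𝔤𝔩(L₂)^{a,b}` then the block sum `X ⊕ Y ∈ ⊕_{a ≤ -1} 𝔤𝔩(L₁ ⊕ L₂)^{a,b}`
(Deligne's bigrading is compatible with `⊕`). [cite: CattaniElZeinGriffithsLe2014, Thm. 7.5.6 and Ex. 3.2.23 (2)] [cite: CattaniDeligneKaplan1995, 2.7 (p. 489)] -/
theorem prodEnd_mem_biSup_endPiece {X : Module.End ℂ (ℂ ⊗[ℚ] V₁)} {Y : Module.End ℂ (ℂ ⊗[ℚ] V₂)}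
    (hX : X ∈ ⨆ ab ∈ {ab : ℤ × ℤ | ab.1 ≤ -1}, L₁.toMixedHodgeStructure.endPiece ab.1 ab.2)
    (hY : Y ∈ ⨆ ab ∈ {ab : ℤ × ℤ | ab.1 ≤ -1}, L₂.toMixedHodgeStructure.endPiece ab.1 ab.2) :
    prodEnd X Y ∈ ⨆ ab ∈ {ab : ℤ × ℤ | ab.1 ≤ -1}, (L₁.prod L₂).toMixedHodgeStructure.endPiece ab.1 ab.2 :=
  HodgeStructure.prodEnd_mem_biSup_endPiece X Y L₁.toMixedHodgeStructure L₂.toMixedHodgeStructure hX hY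

end HodgeTheory.PolarizedLimitMixedHodgeStructure

/-! ## §4 The puncture chart of `D₁ ⊕ D₂` -/

namespace Motives.VHSData.PunctureChart

variable {S : Type} [TopologicalSpace S] {k : ℤ} {D₁ D₂ : VHSData S k}
variable {V₁ V₂ : Type u} [AddCommGroup V₁] [Module ℚ V₁] [FiniteDimensional ℚ V₁] [AddCommGroup V₂] [Module ℚ V₂]
  [FiniteDimensional ℚ V₂] {L₁ : PolarizedLimitMixedHodgeStructure V₁ k} {L₂ : PolarizedLimitMixedHodgeStructure V₂ k} {σ : ℂ → S}
  (C₁ : D₁.PunctureChart σ L₁) (C₂ : D₂.PunctureChart σ L₂)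

/-- **THE DIRECT SUM OF TWO LOCAL PERIOD CHARTS AT A PUNCTURE** (same weight, same covering coordinate `σ`): the chart of `D₁ ⊕ D₂` with limit the polarized
direct sum `L₁ ⊕ L₂ = (W₁ × W₂, F₁ × F₂, N₁ ⊕ N₂, Q₁ ⊕ Q₂)`, gauge the block sum `Γ₁(s) ⊕ Γ₂(s)` (so that `exp Γ = exp Γ₁ ⊕ exp Γ₂` and
`Φ₁(z) × Φ₂(z) = exp(zN)exp(Γ(s))(F₁ × F₂)` — nilpotent orbits and holomorphic gauges add blockwise), lattice `Λ₁ × Λ₂`, trivialization `e₁ × e₂`, height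
`max(A₀,₁, A₀,₂)`. [cite: CattaniElZeinGriffithsLe2014, Def. 8.3.6 (p. 359) and Prop. 8.3.12 (i) (p. 361)] [cite: CattaniDeligneKaplan1995, (2.4), 2.7 (2.7.1) (pp. 488–489)]
[cite: Schmid1973, §2] [cite: Griffiths1970, §1] -/
def prod : (D₁.prod D₂).PunctureChart σ (L₁.prod L₂) where
  Γ s := prodEnd (C₁.Γ s) (C₂.Γ s)
  Γ_zero := by rw [C₁.Γ_zero, C₂.Γ_zero, prodEnd_zero]
  analyticAt_Γ := analyticAt_apply_prodEnd C₁.analyticAt_Γ C₂.analyticAt_Γ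
  Γ_mem s := L₁.prodEnd_mem_biSup_endPiece L₂ (C₁.Γ_mem s) (C₂.Γ_mem s)
  Λ := C₁.Λ.prod C₂.Λ
  fg_Λ := C₁.fg_Λ.prod C₂.fg_Λ
  monodromy_mem := L₁.monodromy_mem_prod L₂ C₁.monodromy_mem C₂.monodromy_mem
  e z := prodTriv D₁ D₂ (C₁.e z) (C₂.e z)
  A₀ := max C₁.A₀ C₂.A₀
  map_F_eq z hz q := by
    have hz₁ : C₁.A₀ ≤ z.im := (le_max_left _ _).trans hz
    have hz₂ : C₂.A₀ ≤ z.im := (le_max_right _ _).trans hz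
    have hn₁ := L₁.toMixedHodgeStructure.isNilpotent_of_mem_biSup_endPiece (C₁.Γ_mem (Complex.exp (2 * Real.pi * Complex.I * z)))
    have hn₂ := L₂.toMixedHodgeStructure.isNilpotent_of_mem_biSup_endPiece (C₂.Γ_mem (Complex.exp (2 * Real.pi * Complex.I * z)))
    have hF₁ : ∀ q : ℤ, ((D₁.hodge (σ z)).F q).map ((C₁.e z).toLinearMap.baseChange ℂ) =
        (L₁.toMixedHodgeStructure.F q).map (IsNilpotent.exp (z • L₁.N.baseChange ℂ) *
          IsNilpotent.exp (C₁.Γ (Complex.exp (2 * Real.pi * Complex.I * z)))) := fun q => by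
      rw [C₁.map_F_eq z hz₁ q, ← Submodule.map_comp, ← Module.End.mul_eq_comp]
    have hF₂ : ∀ q : ℤ, ((D₂.hodge (σ z)).F q).map ((C₂.e z).toLinearMap.baseChange ℂ) =
        (L₂.toMixedHodgeStructure.F q).map (IsNilpotent.exp (z • L₂.N.baseChange ℂ) *
          IsNilpotent.exp (C₂.Γ (Complex.exp (2 * Real.pi * Complex.I * z)))) := fun q => by
      rw [C₂.map_F_eq z hz₂ q, ← Submodule.map_comp, ← Module.End.mul_eq_comp]
    rw [PolarizedLimitMixedHodgeStructure.prod_toLimitMixedHodgeStructure, LimitMixedHodgeStructure.exp_smul_baseChange_prod_N,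
      exp_prodEnd hn₁ hn₂, ← Submodule.map_comp, ← Module.End.mul_eq_comp, ← prodEnd_mul]
    exact map_prod_hodge_F_eq D₁ D₂ (C₁.e z) (C₂.e z) L₁.toMixedHodgeStructure L₂.toMixedHodgeStructure _ _ hF₁ hF₂ q
  form_eq z hz x y :=
    prod_form_eq_chart D₁ D₂ (C₁.e z) (C₂.e z) L₁.Q L₂.Q (C₁.form_eq z ((le_max_left _ _).trans hz)) (C₂.form_eq z ((le_max_right _ _).trans hz)) x y
  e_toRat_mem z hz u :=
    prodTriv_toRat_mem D₁ D₂ (C₁.e z) (C₂.e z) (C₁.e_toRat_mem z ((le_max_left _ _).trans hz)) (C₂.e_toRat_mem z ((le_max_right _ _).trans hz)) u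
  exists_e_toRat_eq z hz v hv :=
    exists_prodTriv_toRat_eq D₁ D₂ (C₁.e z) (C₂.e z) (C₁.exists_e_toRat_eq z ((le_max_left _ _).trans hz))
      (C₂.exists_e_toRat_eq z ((le_max_right _ _).trans hz)) v hv

/-- The gauge of the direct-sum chart is the block sum `Γ₁(s) ⊕ Γ₂(s)`. [cite: CattaniDeligneKaplan1995, 2.7 (p. 489)] -/
@[simp] theorem prod_Γ (s : ℂ) : (C₁.prod C₂).Γ s = prodEnd (C₁.Γ s) (C₂.Γ s) := rfl

/-- The lattice of the direct-sum chart is `Λ₁ × Λ₂`. [cite: Schmid1973, §2] -/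
@[simp] theorem prod_Λ : (C₁.prod C₂).Λ = C₁.Λ.prod C₂.Λ := rfl

/-- The trivialization of the direct-sum chart is `e₁ × e₂`. [cite: Schmid1973, §2] -/
@[simp] theorem prod_e (z : ℂ) : (C₁.prod C₂).e z = prodTriv D₁ D₂ (C₁.e z) (C₂.e z) := rfl

/-- The height of the direct-sum chart is `max(A₀,₁, A₀,₂)`. [cite: CattaniDeligneKaplan1995, (2.4) (p. 488)] -/
@[simp] theorem prod_A₀ : (C₁.prod C₂).A₀ = max C₁.A₀ C₂.A₀ := rfl

/-- `exp` of the direct-sum gauge is `exp Γ₁(s) ⊕ exp Γ₂(s)` (the gauges are nilpotent, lying in `𝔟`). [cite: CattaniDeligneKaplan1995, 2.7 (2.7.1) (p. 489)] -/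
theorem exp_prod_Γ (s : ℂ) : IsNilpotent.exp ((C₁.prod C₂).Γ s) = prodEnd (IsNilpotent.exp (C₁.Γ s)) (IsNilpotent.exp (C₂.Γ s)) :=
  exp_prodEnd (L₁.toMixedHodgeStructure.isNilpotent_of_mem_biSup_endPiece (C₁.Γ_mem s))
    (L₂.toMixedHodgeStructure.isNilpotent_of_mem_biSup_endPiece (C₂.Γ_mem s))

/-- **CDK THEOREM 1.5 (`r = 1`, `m = 0`) FOR THE DIRECT SUM `D₁ ⊕ D₂` near a puncture, from the charts of the summands, WITH SPLIT EQUATIONS**: there are a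
height `A₁` and a FINITE set `Υ ⊆ Λ₁ × Λ₂ ∖ 0` of `N`-invariant limit Hodge classes of `L₁ ⊕ L₂` of norm `≤ K` such that for `Im z ≥ A₁`:
**`σ(z) ∈ hodgeLocusOfNormLe (D₁ ⊕ D₂) p K ⟺ ∃ (v₁, v₂) ∈ Υ, Γ₁(e^{2πiz})(1 ⊗ v₁) = 0 ∧ Γ₂(e^{2πiz})(1 ⊗ v₂) = 0`**.
[cite: CattaniDeligneKaplan1995, Thm. 1.5 (p. 485), 2.7, 2.10 (pp. 489–490)] [cite: CattaniElZeinGriffithsLe2014, Prop. 8.3.12 (i) (p. 361)] -/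
theorem exists_finite_hodgeLocusOfNormLe_prod_iff {p : ℤ} (hpk : p + p = k) (K : ℤ) :
    ∃ A₁ : ℝ, (L₁.prod L₂).normThreshold < A₁ ∧ max C₁.A₀ C₂.A₀ ≤ A₁ ∧ ∃ Υ : Set (V₁ × V₂), Υ.Finite ∧
      (∀ v ∈ Υ, v ∈ C₁.Λ.prod C₂.Λ ∧ v ≠ 0 ∧ (L₁.prod L₂).Q v v ≤ (K : ℚ) ∧ v ∈ (L₁.prod L₂).W k ∧
        (L₁.prod L₂).N v = 0 ∧ ofRat v ∈ (L₁.prod L₂).F p ∧ ofRat v ∈ (L₁.prod L₂).toMixedHodgeStructure.deligneI p p) ∧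
      ∀ z : ℂ, A₁ ≤ z.im →
        (σ z ∈ (D₁.prod D₂).hodgeLocusOfNormLe p K ↔ ∃ v ∈ Υ,
          C₁.Γ (Complex.exp (2 * Real.pi * Complex.I * z)) (ofRat v.1) = 0 ∧ C₂.Γ (Complex.exp (2 * Real.pi * Complex.I * z)) (ofRat v.2) = 0) := by
  obtain ⟨A₁, hA₁, hA₀, Υ, hΥ, hΥp, hiff⟩ := (C₁.prod C₂).exists_finite_hodgeLocusOfNormLe_iff hpk K
  refine ⟨A₁, hA₁, hA₀, Υ, hΥ, hΥp, fun z hz => (hiff z hz).trans ?_⟩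
  simp only [prod_Γ, prodEnd_ofRat_eq_zero_iff]

/-- **EVERYTHING OR NOTHING for `D₁ ⊕ D₂` near a puncture**: beyond some height, either every `σ(z)` carries a nonzero integral pair in `V₁,ℤ ⊕ V₂,ℤ` of
type `(p, p)` with `Q₁(u₁, u₁) + Q₂(u₂, u₂) ≤ K`, or none does. [cite: CattaniDeligneKaplan1995, Thm. 1.5 (p. 485), 2.10–2.12 (pp. 490–491)] -/
theorem forall_mem_hodgeLocusOfNormLe_prod_or_forall_not_mem {p : ℤ} (hpk : p + p = k) (K : ℤ) :
    ∃ A : ℝ, (L₁.prod L₂).normThreshold < A ∧ max C₁.A₀ C₂.A₀ ≤ A ∧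
      ((∀ z : ℂ, A ≤ z.im → σ z ∈ (D₁.prod D₂).hodgeLocusOfNormLe p K) ∨ (∀ z : ℂ, A ≤ z.im → σ z ∉ (D₁.prod D₂).hodgeLocusOfNormLe p K)) :=
  (C₁.prod C₂).forall_mem_hodgeLocusOfNormLe_or_forall_not_mem hpk K

/-- **CDK Lemma 2.11 for `D₁ ⊕ D₂`**: if parallel transport along the loops `γ z` is, in the charts of the summands, the monodromy `Tᵢ`, then beyond some
height every integral pair of type `(p, p)` and norm `≤ K` at `σ(z)` is fixed by `γ z` (its transport is `T₁ ⊕ T₂ = T(L₁ ⊕ L₂)`).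
[cite: CattaniDeligneKaplan1995, Lemma 2.11 (p. 490), (2.4) (p. 488)] -/
theorem transport_prod_eq_self_of_isHodgeAt {p : ℤ} (hpk : p + p = k) (γ : ∀ z : ℂ, Path.Homotopic.Quotient (σ z) (σ z))
    (hγ₁ : ∀ z : ℂ, C₁.A₀ ≤ z.im → ∀ x : D₁.V.fiber (σ z), C₁.e z (D₁.V.transport (γ z) x) = L₁.monodromy (C₁.e z x))
    (hγ₂ : ∀ z : ℂ, C₂.A₀ ≤ z.im → ∀ x : D₂.V.fiber (σ z), C₂.e z (D₂.V.transport (γ z) x) = L₂.monodromy (C₂.e z x)) (K : ℤ) :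
    ∃ A₁ : ℝ, (L₁.prod L₂).normThreshold < A₁ ∧ max C₁.A₀ C₂.A₀ ≤ A₁ ∧
      ∀ z : ℂ, A₁ ≤ z.im → ∀ u : (D₁.prod D₂).VZ.fiber (σ z),
        ((D₁.prod D₂).form (σ z)).form ((D₁.prod D₂).toRat (σ z) u) ((D₁.prod D₂).toRat (σ z) u) ≤ (K : ℚ) →
        (D₁.prod D₂).IsHodgeAt (σ z) p u →
        (D₁.prod D₂).VZ.transport (γ z) u = u ∧ (D₁.prod D₂).V.transport (γ z) ((D₁.prod D₂).toRat (σ z) u) = (D₁.prod D₂).toRat (σ z) u :=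
  (C₁.prod C₂).transport_eq_self_of_isHodgeAt hpk γ (fun z hz x => by
    rw [PolarizedLimitMixedHodgeStructure.prod_monodromy]
    exact prodTriv_transport_eq D₁ D₂ (C₁.e z) (C₂.e z) (γ z) L₁.monodromy L₂.monodromy (hγ₁ z ((le_max_left _ _).trans hz))
      (hγ₂ z ((le_max_right _ _).trans hz)) x) K

end Motives.VHSData.PunctureChart

/-! ## §5 The interior chart of `D₁ ⊕ D₂` -/

namespace Motives.VHSData.InteriorChart

variable {S : Type} [TopologicalSpace S] {k : ℤ} {D₁ D₂ : VHSData S k} {ψ : OpenPartialHomeomorph S ℂ}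
variable {V₁ V₂ : Type u} [AddCommGroup V₁] [Module ℚ V₁] [AddCommGroup V₂] [Module ℚ V₂]
variable {H₀₁ : HodgeStructure V₁ k} {H₀₂ : HodgeStructure V₂ k} {P₀₁ : H₀₁.Polarization} {P₀₂ : H₀₂.Polarization}
variable (C₁ : D₁.InteriorChart ψ P₀₁) (C₂ : D₂.InteriorChart ψ P₀₂)

/-- **THE DIRECT SUM OF TWO INTERIOR CHARTS ON THE SAME COORDINATE DISC**: the chart of `D₁ ⊕ D₂` with reference structure `(H₀₁ ⊕ H₀₂, Q₀₁ ⊕ Q₀₂)`,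
trivialization `e₁ × e₂`, inverse frame `h₁(c) ⊕ h₂(c)` (invertible, holomorphic coefficients: `(h₁ ⊕ h₂)⁻¹(F₀₁ × F₀₂) = h₁⁻¹F₀₁ × h₂⁻¹F₀₂`), lattice
`Λ₁ × Λ₂`, and comparison constant `min(κ₁, κ₂)` (the Hodge metric of an orthogonal direct sum is the orthogonal sum: `Motives/HodgeStructureProdHodgeNorm`).
[cite: CattaniDeligneKaplan1995, §1 (pp. 483–484)] [cite: DeligneHodgeII1971, 2.1 and 2.1.15] [cite: Schmid1973, §2] [cite: CarlsonMullerStachPeters2017, §2.3 Thm. 2.3.3] -/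
def prod : (D₁.prod D₂).InteriorChart ψ (P₀₁.prod P₀₂) where
  isPreconnected_target := C₁.isPreconnected_target
  e c := prodTriv D₁ D₂ (C₁.e c) (C₂.e c)
  h c := prodEnd (C₁.h c) (C₂.h c)
  analyticOnNhd_h φ w c hc := analyticAt_apply_prodEnd (fun φ w => C₁.analyticOnNhd_h φ w c hc) (fun φ w => C₂.analyticOnNhd_h φ w c hc) φ w
  isUnit_h c hc := isUnit_prodEnd (C₁.isUnit_h c hc) (C₂.isUnit_h c hc)
  map_F_eq c hc q := map_prod_hodge_F_eq_comap D₁ D₂ (C₁.e c) (C₂.e c) H₀₁ H₀₂ (C₁.h c) (C₂.h c) (C₁.map_F_eq c hc) (C₂.map_F_eq c hc) q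
  form_eq c hc x y := prod_form_eq_chart D₁ D₂ (C₁.e c) (C₂.e c) P₀₁.form P₀₂.form (C₁.form_eq c hc) (C₂.form_eq c hc) x y
  Λ := C₁.Λ.prod C₂.Λ
  fg_Λ := C₁.fg_Λ.prod C₂.fg_Λ
  e_toRat_mem c hc u := prodTriv_toRat_mem D₁ D₂ (C₁.e c) (C₂.e c) (C₁.e_toRat_mem c hc) (C₂.e_toRat_mem c hc) u
  exists_e_toRat_eq c hc v hv := exists_prodTriv_toRat_eq D₁ D₂ (C₁.e c) (C₂.e c) (C₁.exists_e_toRat_eq c hc) (C₂.exists_e_toRat_eq c hc) v hv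
  κ := min C₁.κ C₂.κ
  κ_pos := lt_min C₁.κ_pos C₂.κ_pos
  mul_hodgeNorm_le c hc w := by
    rw [prodTriv_toLinearMap]
    exact Polarization.mul_hodgeNorm_prodMap_baseChange_le (D₁.form (ψ.symm c)) (D₂.form (ψ.symm c)) P₀₁ P₀₂ (C₁.e c).toLinearMap
      (C₂.e c).toLinearMap C₁.κ_pos C₂.κ_pos (C₁.mul_hodgeNorm_le c hc) (C₂.mul_hodgeNorm_le c hc) w

/-- The trivialization of the direct-sum chart is `e₁ × e₂`. [cite: Schmid1973, §2] -/
@[simp] theorem prod_e (c : ℂ) : (C₁.prod C₂).e c = prodTriv D₁ D₂ (C₁.e c) (C₂.e c) := rfl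

/-- The inverse frame of the direct-sum chart is `h₁ ⊕ h₂`. [cite: CattaniDeligneKaplan1995, §1 (p. 483)] -/
@[simp] theorem prod_h (c : ℂ) : (C₁.prod C₂).h c = prodEnd (C₁.h c) (C₂.h c) := rfl

/-- The lattice of the direct-sum chart is `Λ₁ × Λ₂`. [cite: Schmid1973, §2] -/
@[simp] theorem prod_Λ : (C₁.prod C₂).Λ = C₁.Λ.prod C₂.Λ := rfl

/-- The comparison constant of the direct-sum chart is `min(κ₁, κ₂)`. [cite: CattaniDeligneKaplan1995, §1 (p. 484)] -/
@[simp] theorem prod_κ : (C₁.prod C₂).κ = min C₁.κ C₂.κ := rfl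

end Motives.VHSData.InteriorChart

/-! ## §6 Flatness is stable under `⊕`; the charted classes are closed under `⊕` -/

namespace Motives.VHSData

variable {S : Type} [TopologicalSpace S] {k : ℤ} {D₁ D₂ : VHSData S k}
variable {V₁ V₂ : Type u} [AddCommGroup V₁] [Module ℚ V₁] [AddCommGroup V₂] [Module ℚ V₂]

namespace InteriorChart

variable {ψ : OpenPartialHomeomorph S ℂ} {H₀₁ : HodgeStructure V₁ k} {H₀₂ : HodgeStructure V₂ k} {P₀₁ : H₀₁.Polarization}
  {P₀₂ : H₀₂.Polarization} {C₁ : D₁.InteriorChart ψ P₀₁} {C₂ : D₂.InteriorChart ψ P₀₂}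

/-- **Flat interior charts of `D₁`, `D₂` on the same disc give a flat interior chart of `D₁ ⊕ D₂`** (`InteriorChart.prod`: both summands are flat along
the same in-disc path). [cite: Schmid1973, §2] [cite: CattaniDeligneKaplan1995, §1 (pp. 483–484)] -/
theorem IsFlat.prod (h₁ : C₁.IsFlat) (h₂ : C₂.IsFlat) : (C₁.prod C₂).IsFlat :=
  fun _ _ hc hc' γ hγ w =>
    prodTriv_transport_eq_of_apply_transport_eq D₁ D₂ (C₁.e _) (C₂.e _) (C₁.e _) (C₂.e _) _ (h₁ hc hc' γ hγ) (h₂ hc hc' γ hγ) w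

end InteriorChart

namespace PunctureChart

variable [FiniteDimensional ℚ V₁] [FiniteDimensional ℚ V₂] {σ : ℂ → S} {L₁ : PolarizedLimitMixedHodgeStructure V₁ k}
  {L₂ : PolarizedLimitMixedHodgeStructure V₂ k} {C₁ : D₁.PunctureChart σ L₁} {C₂ : D₂.PunctureChart σ L₂}

/-- **Flat puncture charts of `D₁`, `D₂` along the same end give a flat puncture chart of `D₁ ⊕ D₂`** (common height `max(A₀,₁, A₀,₂)`).
[cite: CattaniDeligneKaplan1995, (2.4) (p. 488)] [cite: Schmid1973, §2] -/
theorem IsFlat.prod (h₁ : C₁.IsFlat) (h₂ : C₂.IsFlat) : (C₁.prod C₂).IsFlat :=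
  fun _ _ γ' γ hγ' hγ w =>
    prodTriv_transport_eq_of_apply_transport_eq D₁ D₂ (C₁.e _) (C₂.e _) (C₁.e _) (C₂.e _) _
      (h₁ γ' γ (fun t => (le_max_left _ _).trans (hγ' t)) hγ) (h₂ γ' γ (fun t => (le_max_right _ _).trans (hγ' t)) hγ) w

end PunctureChart

variable {α ι : Type*} {ψ : α → OpenPartialHomeomorph S ℂ} {σ : ι → ℂ → S}

/-- **`D₁, D₂` charted ⟹ `D₁ ⊕ D₂` charted.** [cite: Schmid1973, §2] [cite: CattaniDeligneKaplan1995, §1 (pp. 483–484)] -/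
theorem IsCharted.prod (h₁ : D₁.IsCharted ψ σ) (h₂ : D₂.IsCharted ψ σ) : (D₁.prod D₂).IsCharted ψ σ := by
  refine ⟨fun a => ?_, fun i => ?_⟩
  · obtain ⟨V₁, _, _, _, H₁, P₁, ⟨C₁⟩⟩ := h₁.interior a
    obtain ⟨V₂, _, _, _, H₂, P₂, ⟨C₂⟩⟩ := h₂.interior a
    exact ⟨V₁ × V₂, inferInstance, inferInstance, inferInstance, H₁.prod H₂, P₁.prod P₂, ⟨C₁.prod C₂⟩⟩
  · obtain ⟨V₁, _, _, _, L₁, ⟨C₁⟩⟩ := h₁.puncture i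
    obtain ⟨V₂, _, _, _, L₂, ⟨C₂⟩⟩ := h₂.puncture i
    exact ⟨V₁ × V₂, inferInstance, inferInstance, inferInstance, L₁.prod L₂, ⟨C₁.prod C₂⟩⟩

/-- **`D₁, D₂` flat-charted ⟹ `D₁ ⊕ D₂` flat-charted.** [cite: Schmid1973, §2] [cite: CattaniDeligneKaplan1995, §1 (pp. 483–484) and (2.4) (p. 488)] -/
theorem IsFlatCharted.prod (h₁ : D₁.IsFlatCharted ψ σ) (h₂ : D₂.IsFlatCharted ψ σ) : (D₁.prod D₂).IsFlatCharted ψ σ := by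
  refine ⟨fun a => ?_, fun i => ?_⟩
  · obtain ⟨V₁, _, _, _, H₁, P₁, C₁, hC₁⟩ := h₁.interior a
    obtain ⟨V₂, _, _, _, H₂, P₂, C₂, hC₂⟩ := h₂.interior a
    exact ⟨V₁ × V₂, inferInstance, inferInstance, inferInstance, H₁.prod H₂, P₁.prod P₂, C₁.prod C₂, hC₁.prod hC₂⟩
  · obtain ⟨V₁, _, _, _, L₁, C₁, hC₁⟩ := h₁.puncture i
    obtain ⟨V₂, _, _, _, L₂, C₂, hC₂⟩ := h₂.puncture i
    exact ⟨V₁ × V₂, inferInstance, inferInstance, inferInstance, L₁.prod L₂, C₁.prod C₂, hC₁.prod hC₂⟩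

/-- **`D₁, D₂` locally charted ⟹ `D₁ ⊕ D₂` locally charted** (shrink both interior charts to the smaller ball, then `InteriorChart.prod`).
[cite: Schmid1973, §2] [cite: CattaniDeligneKaplan1995, §1 (pp. 483–484)] -/
theorem IsLocallyCharted.prod (h₁ : D₁.IsLocallyCharted ψ σ) (h₂ : D₂.IsLocallyCharted ψ σ) : (D₁.prod D₂).IsLocallyCharted ψ σ := by
  refine ⟨fun a x hx => ?_, fun i => ?_⟩
  · obtain ⟨r₁, hr₁, hB₁, V₁, _, _, _, H₁, P₁, ⟨C₁⟩⟩ := h₁.interior a x hx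
    obtain ⟨r₂, hr₂, hB₂, V₂, _, _, _, H₂, P₂, ⟨C₂⟩⟩ := h₂.interior a x hx
    have hB : Metric.ball (ψ a x) (min r₁ r₂) ⊆ (ψ a).target := (Metric.ball_subset_ball (min_le_left _ _)).trans hB₁
    exact ⟨min r₁ r₂, lt_min hr₁ hr₂, hB, V₁ × V₂, inferInstance, inferInstance, inferInstance, H₁.prod H₂, P₁.prod P₂,
      ⟨(C₁.restrBallMono (min_le_left _ _) hB).prod (C₂.restrBallMono (min_le_right _ _) hB)⟩⟩
  · obtain ⟨V₁, _, _, _, L₁, ⟨C₁⟩⟩ := h₁.puncture i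
    obtain ⟨V₂, _, _, _, L₂, ⟨C₂⟩⟩ := h₂.puncture i
    exact ⟨V₁ × V₂, inferInstance, inferInstance, inferInstance, L₁.prod L₂, ⟨C₁.prod C₂⟩⟩

/-- **`D₁, D₂` locally flat-charted ⟹ `D₁ ⊕ D₂` locally flat-charted** (shrink to the smaller ball, then `IsFlat.prod`).
[cite: Schmid1973, §2] [cite: CattaniDeligneKaplan1995, §1 (pp. 483–484) and (2.4) (p. 488)] -/
theorem IsLocallyFlatCharted.prod (h₁ : D₁.IsLocallyFlatCharted ψ σ) (h₂ : D₂.IsLocallyFlatCharted ψ σ) : (D₁.prod D₂).IsLocallyFlatCharted ψ σ := by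
  refine ⟨fun a x hx => ?_, fun i => ?_⟩
  · obtain ⟨r₁, hr₁, hB₁, V₁, _, _, _, H₁, P₁, C₁, hC₁⟩ := h₁.interior a x hx
    obtain ⟨r₂, hr₂, hB₂, V₂, _, _, _, H₂, P₂, C₂, hC₂⟩ := h₂.interior a x hx
    have hB : Metric.ball (ψ a x) (min r₁ r₂) ⊆ (ψ a).target := (Metric.ball_subset_ball (min_le_left _ _)).trans hB₁
    exact ⟨min r₁ r₂, lt_min hr₁ hr₂, hB, V₁ × V₂, inferInstance, inferInstance, inferInstance, H₁.prod H₂, P₁.prod P₂,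
      (C₁.restrBallMono (min_le_left _ _) hB).prod (C₂.restrBallMono (min_le_right _ _) hB),
      (hC₁.restrBallMono (min_le_left _ _) hB).prod (hC₂.restrBallMono (min_le_right _ _) hB)⟩
  · obtain ⟨V₁, _, _, _, L₁, C₁, hC₁⟩ := h₁.puncture i
    obtain ⟨V₂, _, _, _, L₂, C₂, hC₂⟩ := h₂.puncture i
    exact ⟨V₁ × V₂, inferInstance, inferInstance, inferInstance, L₁.prod L₂, C₁.prod C₂, hC₁.prod hC₂⟩

/-! ## §7 Cattani–Deligne–Kaplan over a curve for `D₁ ⊕ D₂` from the charts of the summands -/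

/-- **CDK THEOREM 1.1 / COROLLARY 1.2 (`r = 1`) FOR `D₁ ⊕ D₂` OVER A CURVE FROM LOCAL CHARTS OF THE SUMMANDS**: `S` preconnected, covered by the discs, with
open ends beyond the heights `A i` and a compact core; then for `p + p = k` and every `K` the set of points carrying a nonzero integral pair
`(u₁, u₂) ∈ V₁,ℤ,s ⊕ V₂,ℤ,s` of type `(p, p)` with `Q₁(u₁, u₁) + Q₂(u₂, u₂) ≤ K` is ALL of `S` or FINITE (by the tree's chart-free
`hodgeLocusOfNormLe_prod_eq_union` this locus is `HL(D₁; p, K) ∪ HL(D₂; p, K)`). [cite: CattaniDeligneKaplan1995, Thm. 1.1, Cor. 1.2 (p. 484), Thm. 1.5 and «1.5 ⟹ 1.1» (p. 485)] -/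
theorem hodgeLocusOfNormLe_prod_eq_univ_or_finite [PreconnectedSpace S] (h₁ : D₁.IsLocallyCharted ψ σ) (h₂ : D₂.IsLocallyCharted ψ σ) {p : ℤ}
    (hpk : p + p = k) (K : ℤ) (hcov : ∀ x : S, ∃ a, x ∈ (ψ a).source) (A : ι → ℝ)
    (hopen : ∀ (i : ι) (A' : ℝ), A i ≤ A' → IsOpen (σ i '' {z : ℂ | A' < z.im}))
    (hcore : ∀ A' : ι → ℝ, (∀ i, A i ≤ A' i) → ∃ K₀ : Set S, IsCompact K₀ ∧ K₀ ∪ ⋃ i, σ i '' {z : ℂ | A' i < z.im} = univ) :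
    (D₁.prod D₂).hodgeLocusOfNormLe p K = univ ∨ ((D₁.prod D₂).hodgeLocusOfNormLe p K).Finite :=
  (h₁.prod h₂).hodgeLocusOfNormLe_eq_univ_or_finite hpk K hcov A hopen hcore

variable {X : Type*} [TopologicalSpace X] [CompactSpace X]

/-- **THEOREM 1.1 FOR `D₁ ⊕ D₂` OVER A PUNCTURED COMPACT CURVE** (ends and core from a compactification `j : S ↪ X`).
[cite: CattaniDeligneKaplan1995, Thm. 1.1, Cor. 1.2 (p. 484), 2.3 (p. 487)] -/
theorem hodgeLocusOfNormLe_prod_eq_univ_or_finite_of_compactification [PreconnectedSpace S] (h₁ : D₁.IsLocallyCharted ψ σ) (h₂ : D₂.IsLocallyCharted ψ σ)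
    {p : ℤ} (hpk : p + p = k) (K : ℤ) (hcov : ∀ x : S, ∃ a, x ∈ (ψ a).source) (A : ι → ℝ)
    {j : S → X} (hj : IsEmbedding j) (pt : ι → X) (hpS : ∀ i, pt i ∉ range j) (hcovX : ∀ x : X, x ∉ range j → ∃ i, x = pt i)
    (φ : ι → OpenPartialHomeomorph X ℂ) (hp : ∀ i, pt i ∈ (φ i).source) (hφp : ∀ i, φ i (pt i) = 0)
    (hball : ∀ i, Metric.ball (0 : ℂ) (Real.exp (-(2 * Real.pi * A i))) ⊆ (φ i).target)
    (hσ : ∀ (i : ι) (z : ℂ), A i < z.im → j (σ i z) = (φ i).symm (Complex.exp (2 * Real.pi * Complex.I * z))) :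
    (D₁.prod D₂).hodgeLocusOfNormLe p K = univ ∨ ((D₁.prod D₂).hodgeLocusOfNormLe p K).Finite :=
  (h₁.prod h₂).hodgeLocusOfNormLe_eq_univ_or_finite_of_compactification hpk K hcov A hj pt hpS hcovX φ hp hφp hball hσ

/-- **CDK COROLLARY 1.3 (`r = 1`) FOR `D₁ ⊕ D₂` FROM LOCAL FLAT CHARTS OF THE SUMMANDS**: for `p + p = k` and a pair `u₀ = (u₁, u₂) ∈ V₁,ℤ,s₀ ⊕ V₂,ℤ,s₀`,
the set of `t ∈ S` where SOME path class `γ` makes `γ · u₀ = (γ · u₁, γ · u₂)` of type `(p, p)` — i.e. BOTH determinations Hodge along ONE path class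
(`isHodgeAt_prod_iff`) — is ALL of `S` or FINITE. [cite: CattaniDeligneKaplan1995, Cor. 1.3 (p. 484), Thm. 1.5 and «Proof of 1.5 ⟹ 1.1» (p. 485)]
[cite: Schmid1973, §2 (cite only)] -/
theorem determinationLocus_prod_eq_univ_or_finite [PreconnectedSpace S] (h₁ : D₁.IsLocallyFlatCharted ψ σ) (h₂ : D₂.IsLocallyFlatCharted ψ σ)
    {p : ℤ} (hpk : p + p = k) {s₀ : S} (u₀ : (D₁.prod D₂).VZ.fiber s₀) (hcov : ∀ x : S, ∃ a, x ∈ (ψ a).source) (A : ι → ℝ)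
    (hopen : ∀ (i : ι) (A' : ℝ), A i ≤ A' → IsOpen (σ i '' {z : ℂ | A' < z.im}))
    (hcore : ∀ A' : ι → ℝ, (∀ i, A i ≤ A' i) → ∃ K₀ : Set S, IsCompact K₀ ∧ K₀ ∪ ⋃ i, σ i '' {z : ℂ | A' i < z.im} = univ)
    (hcont : ∀ i, ContinuousOn (σ i) {z : ℂ | A i < z.im}) :
    {t : S | ∃ γ : Path.Homotopic.Quotient s₀ t, (D₁.prod D₂).IsHodgeAt t p ((D₁.prod D₂).VZ.transport γ u₀)} = univ ∨
      {t : S | ∃ γ : Path.Homotopic.Quotient s₀ t, (D₁.prod D₂).IsHodgeAt t p ((D₁.prod D₂).VZ.transport γ u₀)}.Finite :=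
  (h₁.prod h₂).determinationLocus_eq_univ_or_finite hpk u₀ hcov A hopen hcore hcont

/-- **COR. 1.3 FOR `D₁ ⊕ D₂` OVER A PUNCTURED COMPACT CURVE** (ends, core and continuity of the ends from a compactification).
[cite: CattaniDeligneKaplan1995, Cor. 1.3 (p. 484), 2.3 (p. 487)] -/
theorem determinationLocus_prod_eq_univ_or_finite_of_compactification [PreconnectedSpace S] (h₁ : D₁.IsLocallyFlatCharted ψ σ)
    (h₂ : D₂.IsLocallyFlatCharted ψ σ) {p : ℤ} (hpk : p + p = k) {s₀ : S} (u₀ : (D₁.prod D₂).VZ.fiber s₀) (hcov : ∀ x : S, ∃ a, x ∈ (ψ a).source)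
    (A : ι → ℝ) {j : S → X} (hj : IsEmbedding j) (pt : ι → X) (hpS : ∀ i, pt i ∉ range j) (hcovX : ∀ x : X, x ∉ range j → ∃ i, x = pt i)
    (φ : ι → OpenPartialHomeomorph X ℂ) (hp : ∀ i, pt i ∈ (φ i).source) (hφp : ∀ i, φ i (pt i) = 0)
    (hball : ∀ i, Metric.ball (0 : ℂ) (Real.exp (-(2 * Real.pi * A i))) ⊆ (φ i).target)
    (hσ : ∀ (i : ι) (z : ℂ), A i < z.im → j (σ i z) = (φ i).symm (Complex.exp (2 * Real.pi * Complex.I * z))) :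
    {t : S | ∃ γ : Path.Homotopic.Quotient s₀ t, (D₁.prod D₂).IsHodgeAt t p ((D₁.prod D₂).VZ.transport γ u₀)} = univ ∨
      {t : S | ∃ γ : Path.Homotopic.Quotient s₀ t, (D₁.prod D₂).IsHodgeAt t p ((D₁.prod D₂).VZ.transport γ u₀)}.Finite :=
  (h₁.prod h₂).determinationLocus_eq_univ_or_finite_of_compactification hpk u₀ hcov A hj pt hpS hcovX φ hp hφp hball hσ

end Motives.VHSData

end Literature.AlgebraicGeometry

end
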